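import Summits.Parity.GeneralizedHardyLittlewood.Theorems.LeeYangFibresHyperbolicityClipsParity
import Summits.Parity.GeneralizedHardyLittlewood.Theorems.LeeYangFibresModelCellFactsParityPoint
import HarnessLib

/-!
# Route `LeeYangFibres`, crux `AbsoluteUpgrade` (stmt-Parity-14116), line `dip-margin-rate-exchange`:
# clipping the odd part of ONE fibre through the margin (helper for the stub `stub_quantClip`)

Helper file 1/· for the registered stub `stub_quantClip` (the RATE version of the proved clipping lemma
`Theorems.HyperbolicityClipsParity_proof`).  In the proved lemma the odd Walsh part `β(w)` of a fibre main
term is clipped by NEWTON's inequalities at two bulk indices (`HyperbolicityClipsParity.beta_bound`); here the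
WHOLE normalised fibre row is fed to an abstract margin statement (the body of `MarginPoly` at one roughness
`u`, for abstract densities `I j`), and real-rootedness of the fibre contradicts the margin's non-real zero
unless `|β(w)| < ϑ α(w)`:

* `quantClip_fibreFactor` — the fibre polynomial with REAL cell data factors as `ζ · Σ_{j<u} p_{j+1} ζ^j`,
  `p_n = Σ_{j_i = n} C_j ∏_{k ≠ i} w_k^{j_k}` (regrouping by the free exponent, as `ModelTransfer.fibreExpand`);
* `quantClip_marginCore` — pure real algebra: coefficients `p_n ≥ 0` with
  `|p_n κ − M d_n (α + (-1)^{n+1} β)| ≤ ν₀ M Π`, densities `d_n` within relative `εa` of `I_{n}` (`I 0 ≥ 1`,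
  `I 1 ≥ 1/2`), a margin hypothesis at threshold `ϑ` with robustness `(r, f)` and a real-rootedness hypothesis
  for `Σ_{j<u} p_{j+1} ζ^j` force `|β| ≤ (B ϑ + 4 ν₀) Π` whenever `|α| ≤ B Π`, `3 εa ≤ r`, `4 ν₀ ≤ ϑ`, `ν₀ ≤ ϑ f`;
* `quantClip_marginBeta` (registered helper) — the fibre-level consequence replacing `beta_bound`:
  `|β(w)| ≤ (2^t ϑ + 4 ν₀) ∏_{k ≠ i} F(w_k)`.

Everything is finite algebra over `ℝ`/`ℂ`; no named facts are used.
-/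

noncomputable section

namespace Summit.Parity.GeneralizedHardyLittlewood.Cruxes.AbsoluteUpgrade.DipMarginRateExchange

open scoped BigOperators
open Finset
open Summit.Parity.GeneralizedHardyLittlewood.Theorems.HyperbolicityClipsParity
open Summit.Parity.GeneralizedHardyLittlewood.Theorems.ModelCellFacts (sum_Icc_one_eq_sum_range)

/-! ## The fibre polynomial factors through the reduced row -/

/-- **The fibre polynomial, regrouped and factored**: for real cell data `C_j` on the box `[1,u]^t`,
`Σ_j C_j ∏_k (ζ | w_k)^{j_k} = ζ · Σ_{n<u} p_{n+1} ζ^n` with `p_n = Σ_{j_i = n} C_j ∏_{k ≠ i} w_k^{j_k}`. -/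
theorem quantClip_fibreFactor {t u : ℕ} (i : Fin t) (C : (Fin t → ℕ) → ℝ) (w : Fin t → ℝ) (z : ℂ) :
    (∑ j ∈ Fintype.piFinset (fun _ : Fin t => Finset.Icc 1 u),
        (C j : ℂ) * ∏ k, (if k = i then z else ((w k : ℝ) : ℂ)) ^ (j k)) =
      z * ∑ n ∈ Finset.range u,
        ((∑ j ∈ (Fintype.piFinset (fun _ : Fin t => Finset.Icc 1 u)).filter (fun j => j i = n + 1),
            C j * ∏ k ∈ Finset.univ.erase i, w k ^ (j k) : ℝ) : ℂ) * z ^ n := by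
  classical
  have hterm : ∀ j : Fin t → ℕ, (C j : ℂ) * ∏ k, (if k = i then z else ((w k : ℝ) : ℂ)) ^ (j k) =
      ((C j * ∏ k ∈ Finset.univ.erase i, w k ^ (j k) : ℝ) : ℂ) * z ^ (j i) := by
    intro j
    rw [← Finset.mul_prod_erase Finset.univ _ (Finset.mem_univ i), if_pos rfl]
    have : ∏ k ∈ Finset.univ.erase i, (if k = i then z else ((w k : ℝ) : ℂ)) ^ (j k) =
        ∏ k ∈ Finset.univ.erase i, ((w k : ℝ) : ℂ) ^ (j k) :=
      Finset.prod_congr rfl fun k hk => by rw [if_neg (Finset.ne_of_mem_erase hk)]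
    rw [this]
    push_cast
    ring
  rw [Finset.sum_congr rfl fun j _ => hterm j]
  have hmaps : ∀ j ∈ Fintype.piFinset (fun _ : Fin t => Finset.Icc 1 u), j i ∈ Finset.Icc 1 u :=
    fun j hj => Fintype.mem_piFinset.mp hj i
  rw [← Finset.sum_fiberwise_of_maps_to hmaps, sum_Icc_one_eq_sum_range, Finset.mul_sum]
  refine Finset.sum_congr rfl fun n _ => ?_
  rw [Complex.ofReal_sum, Finset.sum_mul, Finset.mul_sum]
  refine Finset.sum_congr rfl fun j hj => ?_
  rw [(Finset.mem_filter.mp hj).2, pow_succ]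
  push_cast
  ring

/-! ## The margin core: pure real algebra -/

/-- **The margin core.**  Abstract fibre coefficients `p_n ≥ 0` (`1 ≤ n ≤ u`) with
`|p_n κ − M d_n (α + (-1)^{n+1} β)| ≤ ν₀ M Π`, densities `|d_n − I_{n-1}| ≤ εa I_{n-1}` (`I ≥ 0`, `I 0 ≥ 1`,
`I 1 ≥ 1/2`, `εa ≤ 1/2`), `|α| ≤ B Π` (`B ≥ 1`), the margin statement at threshold `ϑ` with robustness
`(r, f)` for the densities `I`, and real-rootedness of `Σ_{j<u} p_{j+1} ζ^j`, give `|β| ≤ (B ϑ + 4 ν₀) Π`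
provided `3 εa ≤ r`, `4 ν₀ ≤ ϑ`, `ν₀ ≤ ϑ f`.  (Case `α < ϑ Π`: `p_1, p_2 ≥ 0` give `|β| ≤ α + 4 ν₀ Π`; case
`α ≥ ϑ Π`: the row `b_j = p_{j+1} κ/(M α)` is non-negative and `(r I_j + f)`-close to `(1 + θ_w (-1)^j) I_j`,
`θ_w = β/α`, `|θ_w| ≤ 2`, so `|θ_w| ≥ ϑ` would produce a non-real zero of the real-rooted row.) -/
theorem quantClip_marginCore {u : ℕ} (hu : 2 ≤ u) {α β PiF ϑ ν₀ r f εa κ M B : ℝ}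
    (hPiF : 0 < PiF) (hϑ : 0 < ϑ) (hν₀ : 0 ≤ ν₀) (hκ : 0 < κ) (hM : 0 < M)
    (hεa : εa ≤ 1 / 2) (hB : 1 ≤ B) (hα : |α| ≤ B * PiF)
    (P d I : ℕ → ℝ) (hI : ∀ j, 0 ≤ I j) (hI0 : 1 ≤ I 0) (hI1 : 1 / 2 ≤ I 1)
    (hP0 : ∀ n ∈ Finset.Icc 1 u, 0 ≤ P n)
    (hP : ∀ n ∈ Finset.Icc 1 u, |P n * κ - M * d n * (α + (-1) ^ (n + 1) * β)| ≤ ν₀ * M * PiF)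
    (hanat : ∀ n ∈ Finset.Icc 1 u, |d n - I (n - 1)| ≤ εa * I (n - 1))
    (hmargin : ∀ θ' : ℝ, ϑ ≤ |θ'| → |θ'| ≤ 2 → ∀ b : ℕ → ℝ, (∀ j : ℕ, j < u → 0 ≤ b j) →
      (∀ j : ℕ, j < u → |b j - (1 + θ' * (-1) ^ j) * I j| ≤ r * I j + f) →
      ∃ z : ℂ, (∑ j ∈ Finset.range u, (b j : ℂ) * z ^ j) = 0 ∧ z.im ≠ 0)
    (hroots : ∀ z : ℂ, (∑ j ∈ Finset.range u, (P (j + 1) : ℂ) * z ^ j) = 0 → z.im = 0)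
    (hr : 3 * εa ≤ r) (hν₁ : 4 * ν₀ ≤ ϑ) (hν₂ : ν₀ ≤ ϑ * f) :
    |β| ≤ (B * ϑ + 4 * ν₀) * PiF := by
  have hu1 : 1 ≤ u := le_trans one_le_two hu
  have h1mem : (1 : ℕ) ∈ Finset.Icc 1 u := Finset.mem_Icc.2 ⟨le_rfl, hu1⟩
  have h2mem : (2 : ℕ) ∈ Finset.Icc 1 u := Finset.mem_Icc.2 ⟨one_le_two, hu⟩
  have hνPiF : 0 ≤ ν₀ * PiF := mul_nonneg hν₀ hPiF.le
  have hf : 0 ≤ f := by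
    by_contra hf
    push Not at hf
    have : ϑ * f < 0 := mul_neg_of_pos_of_neg hϑ hf
    linarith
  -- the two lowest densities
  have hd1 : 1 / 2 ≤ d 1 := by
    have h := (abs_le.1 (hanat 1 h1mem)).1
    simp only [Nat.sub_self] at h
    nlinarith [mul_nonneg (sub_nonneg.2 hεa) (sub_nonneg.2 hI0), hI 0]
  have hd2 : 1 / 4 ≤ d 2 := by
    have h := (abs_le.1 (hanat 2 h2mem)).1
    norm_num at h
    nlinarith [mul_nonneg (sub_nonneg.2 hεa) (sub_nonneg.2 hI1), hI 1]
  -- Step A: `p_1, p_2 ≥ 0` bound `β` by `α`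
  have hA1 : -(2 * (ν₀ * PiF)) ≤ α + β := by
    have h := (abs_le.1 (hP 1 h1mem)).2
    have h0 := hP0 1 h1mem
    norm_num at h
    have h2 : -(ν₀ * PiF) ≤ d 1 * (α + β) := by
      refine le_of_mul_le_mul_left ?_ hM
      nlinarith [mul_nonneg h0 hκ.le]
    by_cases hs : 0 ≤ α + β
    · linarith
    · push Not at hs
      have := mul_le_mul_of_nonpos_right hd1 hs.le
      linarith
  have hA2 : -(4 * (ν₀ * PiF)) ≤ α - β := by
    have h := (abs_le.1 (hP 2 h2mem)).2
    have h0 := hP0 2 h2mem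
    norm_num at h
    have h2 : -(ν₀ * PiF) ≤ d 2 * (α - β) := by
      refine le_of_mul_le_mul_left ?_ hM
      nlinarith [mul_nonneg h0 hκ.le]
    by_cases hs : 0 ≤ α - β
    · linarith
    · push Not at hs
      have := mul_le_mul_of_nonpos_right hd2 hs.le
      linarith
  have hβA : |β| ≤ α + 4 * (ν₀ * PiF) := by
    rw [abs_le]; constructor <;> linarith
  -- Step B: the two cases on `α`
  by_cases hcase : α < ϑ * PiF
  · calc |β| ≤ α + 4 * (ν₀ * PiF) := hβA
      _ ≤ ϑ * PiF + 4 * (ν₀ * PiF) := by linarith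
      _ ≤ (B * ϑ + 4 * ν₀) * PiF := by
          nlinarith [mul_nonneg (sub_nonneg.2 hB) (mul_nonneg hϑ.le hPiF.le)]
  push Not at hcase
  have hαpos : 0 < α := lt_of_lt_of_le (mul_pos hϑ hPiF) hcase
  have hMα : 0 < M * α := mul_pos hM hαpos
  set θw : ℝ := β / α with hθw
  have hβeq : β = θw * α := by rw [hθw]; field_simp
  have hθw2 : |θw| ≤ 2 := by
    rw [hθw, abs_div, abs_of_pos hαpos, div_le_iff₀ hαpos]
    nlinarith [mul_le_mul_of_nonneg_right hν₁ hPiF.le]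
  have hθwlt : |θw| < ϑ := by
    by_contra hge
    push Not at hge
    -- the normalised row
    have hb0 : ∀ j : ℕ, j < u → 0 ≤ P (j + 1) * κ / (M * α) := fun j hj =>
      div_nonneg (mul_nonneg (hP0 (j + 1) (Finset.mem_Icc.2 ⟨by omega, by omega⟩)) hκ.le) hMα.le
    have hclose : ∀ j : ℕ, j < u →
        |P (j + 1) * κ / (M * α) - (1 + θw * (-1) ^ j) * I j| ≤ r * I j + f := by
      intro j hj
      have hn : j + 1 ∈ Finset.Icc 1 u := Finset.mem_Icc.2 ⟨by omega, by omega⟩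
      have h1 := hP (j + 1) hn
      have h2 := hanat (j + 1) hn
      rw [Nat.add_sub_cancel] at h2
      have hsign : (-1 : ℝ) ^ (j + 1 + 1) = (-1) ^ j := by rw [pow_succ, pow_succ]; ring
      rw [hsign] at h1
      have hsplit : P (j + 1) * κ / (M * α) - (1 + θw * (-1) ^ j) * I j =
          (P (j + 1) * κ - M * d (j + 1) * (α + (-1) ^ j * β)) / (M * α) +
            (1 + θw * (-1) ^ j) * (d (j + 1) - I j) := by
        rw [hβeq]
        field_simp
        ring
      rw [hsplit]
      refine (abs_add_le _ _).trans ?_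
      have e1 : |(P (j + 1) * κ - M * d (j + 1) * (α + (-1) ^ j * β)) / (M * α)| ≤ f := by
        rw [abs_div, abs_of_pos hMα, div_le_iff₀ hMα]
        calc |P (j + 1) * κ - M * d (j + 1) * (α + (-1) ^ j * β)| ≤ ν₀ * M * PiF := h1
          _ ≤ ϑ * f * M * PiF := by gcongr
          _ = f * M * (ϑ * PiF) := by ring
          _ ≤ f * M * α := by gcongr
          _ = f * (M * α) := by ring
      have e2 : |(1 + θw * (-1) ^ j) * (d (j + 1) - I j)| ≤ r * I j := by
        rw [abs_mul]
        have hone : |(-1 : ℝ) ^ j| = 1 := by rw [abs_pow, abs_neg, abs_one, one_pow]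
        have hfac : |1 + θw * (-1) ^ j| ≤ 3 :=
          calc |1 + θw * (-1) ^ j| ≤ |(1 : ℝ)| + |θw * (-1) ^ j| := abs_add_le _ _
            _ = 1 + |θw| := by rw [abs_one, abs_mul, hone, mul_one]
            _ ≤ 3 := by linarith
        calc |1 + θw * (-1) ^ j| * |d (j + 1) - I j| ≤ 3 * (εa * I j) :=
              mul_le_mul hfac h2 (abs_nonneg _) (by norm_num)
          _ = 3 * εa * I j := by ring
          _ ≤ r * I j := mul_le_mul_of_nonneg_right hr (hI j)
      linarith
    obtain ⟨z, hz, hzim⟩ := hmargin θw hge hθw2 (fun j => P (j + 1) * κ / (M * α)) hb0 hclose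
    apply hzim
    apply hroots z
    have hz' : (∑ j ∈ Finset.range u, ((P (j + 1) * κ / (M * α) : ℝ) : ℂ) * z ^ j) = 0 := hz
    have hsum : (∑ j ∈ Finset.range u, ((P (j + 1) * κ / (M * α) : ℝ) : ℂ) * z ^ j) =
        ((κ / (M * α) : ℝ) : ℂ) * ∑ j ∈ Finset.range u, (P (j + 1) : ℂ) * z ^ j := by
      rw [Finset.mul_sum]
      refine Finset.sum_congr rfl fun j _ => ?_
      push_cast
      ring
    rw [hsum] at hz'
    rcases mul_eq_zero.1 hz' with h | h
    · exfalso
      have : κ / (M * α) = 0 := by exact_mod_cast h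
      exact absurd this (div_pos hκ hMα).ne'
    · exact h
  have hαle : α ≤ B * PiF := (le_abs_self α).trans hα
  have hid : (B * ϑ + 4 * ν₀) * PiF = ϑ * (B * PiF) + 4 * (ν₀ * PiF) := by ring
  calc |β| = |θw| * α := by rw [hβeq, abs_mul, abs_of_pos hαpos]
    _ ≤ ϑ * α := mul_le_mul_of_nonneg_right hθwlt.le hαpos.le
    _ ≤ ϑ * (B * PiF) := mul_le_mul_of_nonneg_left hαle hϑ.le
    _ ≤ (B * ϑ + 4 * ν₀) * PiF := by rw [hid]; linarith

/-! ## Clipping the odd part of one fibre through the margin -/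

/-- **Clipping the odd part of ONE fibre through the margin** (the rate replacement of
`HyperbolicityClipsParity.beta_bound`).  For frozen fugacities `w ∈ (0,1]^t` (the `i`-th is ignored), cell data
`C_j ≥ 0` obeying the cell-parity law with error `E₀`, model densities `a_n ≥ 0` whose rescalings `a_n κ` are
within relative `εa ≤ 1/2` of abstract densities `I_{n-1}` (`I ≥ 0`, `I 0 ≥ 1`, `I 1 ≥ 1/2`), a real-rooted fibre
through `i` at `w`, and the margin statement for `I` at threshold `ϑ` with robustness `(r, f)`: if `3 εa ≤ r`,
`4 ν₀ ≤ ϑ`, `ν₀ ≤ ϑ f` and `E₀ u^{t-1} κ ≤ ν₀ M a_1^{t-1}`, then the odd Walsh part of the fibre main term obeys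
`|β(w)| ≤ (2^t ϑ + 4 ν₀) ∏_{k ≠ i} F(w_k)`. -/
theorem quantClip_marginBeta : ∀ {t u : ℕ} (i : Fin t), 2 ≤ u → ∀ θ : Finset (Fin t) → ℝ, (∀ S, |θ S| ≤ 2) → ∀ a : ℕ → ℝ, (∀ n, 0 ≤ a n) → 0 < a 1 → ∀ I : ℕ → ℝ, (∀ j, 0 ≤ I j) → 1 ≤ I 0 → 1 / 2 ≤ I 1 → ∀ {κ εa : ℝ}, 0 < κ → εa ≤ 1 / 2 → (∀ n ∈ Finset.Icc 1 u, |a n * κ - I (n - 1)| ≤ εa * I (n - 1)) → ∀ C : (Fin t → ℕ) → ℝ, (∀ j, 0 ≤ C j) → ∀ {M : ℝ}, 0 < M → ∀ {E₀ : ℝ}, 0 ≤ E₀ → (∀ j ∈ Fintype.piFinset (fun _ : Fin t => Finset.Icc 1 u), |C j - (∑ S : Finset (Fin t), θ S * ∏ k ∈ S, (-1 : ℝ) ^ (j k + 1)) * (M * ∏ k, a (j k))| ≤ E₀) → ∀ w : Fin t → ℝ, (∀ k, 0 < w k ∧ w k ≤ 1) → (∀ z : ℂ, (∑ j ∈ Fintype.piFinset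 (fun _ : Fin t => Finset.Icc 1 u), (C j : ℂ) * ∏ k, (if k = i then z else ((w k : ℝ) : ℂ)) ^ (j k)) = 0 → z.im = 0) → ∀ {ϑ r f ν₀ : ℝ}, 0 < ϑ → 0 ≤ ν₀ → (∀ θ' : ℝ, ϑ ≤ |θ'| → |θ'| ≤ 2 → ∀ b : ℕ → ℝ, (∀ j : ℕ, j < u → 0 ≤ b j) → (∀ j : ℕ, j < u → |b j - (1 + θ' * (-1) ^ j) * I j| ≤ r * I j + f) → ∃ z : ℂ, (∑ j ∈ Finset.range u, (b j : ℂ) * z ^ j) = 0 ∧ z.im ≠ 0) → 3 * εa ≤ r → 4 * ν₀ ≤ ϑ → ν₀ ≤ ϑ * f → E₀ * (u : ℝ) ^ (t - 1) * κ ≤ ν₀ * M * a 1 ^ (t - 1) → |∑ T ∈ (Finset.univ.erase i).powerset, θ (insert i T) * ∏ k ∈ Finset.univ.erase i, ∑ n ∈ Finset.Icc 1 u, (if k ∈ T then (-1 : ℝ) ^ (n + 1) else 1) * a n * w k ^ n| ≤ (2 ^ t * ϑ + 4 * ν₀) * ∏ k ∈ Finset.univ.erase i, ∑ n ∈ Finset.Icc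 1 u, a n * w k ^ n := by
  intro t u i hu θ hθ a ha ha1 I hI hI0 hI1 κ εa hκ hεa hanat C hC M hM E₀ hE₀ hlaw w hw hhyp ϑ r f ν₀ hϑ hν₀
    hmargin hr hν₁ hν₂ hsmall
  have ht : t - 1 + 1 = t := Nat.sub_add_cancel (Nat.succ_le_of_lt i.pos)
  have hcard : (Finset.univ.erase i).card = t - 1 := by
    rw [Finset.card_erase_of_mem (Finset.mem_univ i), Finset.card_univ, Fintype.card_fin]
  have hu1 : 1 ≤ u := le_trans one_le_two hu
  -- scale and Walsh bounds
  have hW0 : 0 ≤ ∏ k ∈ Finset.univ.erase i, w k := Finset.prod_nonneg fun k _ => (hw k).1.le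
  have hscale := fibre_scale_lower (Finset.univ.erase i) hu1 ha w hw
  have hαb := fibre_walsh_bound (u := u) (Finset.univ.erase i) θ (fun T => hθ T) ha w
    (fun k => (hw k).1.le)
  rw [hcard] at hscale hαb
  have hFpos : ∀ k, 0 < ∑ n ∈ Finset.Icc 1 u, a n * w k ^ n := fun k =>
    lt_of_lt_of_le (mul_pos ha1 (hw k).1) (a_one_mul_le_F hu1 ha (hw k).1.le)
  have hPipos : 0 < ∏ k ∈ Finset.univ.erase i, ∑ n ∈ Finset.Icc 1 u, a n * w k ^ n :=
    Finset.prod_pos fun k _ => hFpos k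
  -- the fibre coefficients: decomposition, error after multiplying by `κ`, non-negativity
  have key : ∀ m ∈ Finset.Icc 1 u,
      |(∑ j ∈ (Fintype.piFinset fun _ : Fin t => Finset.Icc 1 u).filter (fun j => j i = m),
          C j * ∏ k ∈ Finset.univ.erase i, w k ^ (j k)) * κ -
        M * (a m * κ) *
          ((∑ T ∈ (Finset.univ.erase i).powerset, θ T * ∏ k ∈ Finset.univ.erase i,
              ∑ n ∈ Finset.Icc 1 u, (if k ∈ T then (-1 : ℝ) ^ (n + 1) else 1) * a n * w k ^ n) +
           (-1 : ℝ) ^ (m + 1) *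
            ∑ T ∈ (Finset.univ.erase i).powerset, θ (insert i T) * ∏ k ∈ Finset.univ.erase i,
              ∑ n ∈ Finset.Icc 1 u, (if k ∈ T then (-1 : ℝ) ^ (n + 1) else 1) * a n * w k ^ n)| ≤
        ν₀ * M * ∏ k ∈ Finset.univ.erase i, ∑ n ∈ Finset.Icc 1 u, a n * w k ^ n := by
    intro m hm
    have hdec := fibre_decomp i hm θ a w M C
    have herr := fibre_err i hm θ a w hw M C hE₀ hlaw
    rw [hcard] at herr
    rw [hdec]
    rw [show ∀ (x e : ℝ), (M * a m * x + e) * κ - M * (a m * κ) * x = e * κ from fun x e => by ring,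
      abs_mul, abs_of_pos hκ]
    calc _ ≤ E₀ * (u : ℝ) ^ (t - 1) * (∏ k ∈ Finset.univ.erase i, w k) * κ :=
          mul_le_mul_of_nonneg_right herr hκ.le
      _ = E₀ * (u : ℝ) ^ (t - 1) * κ * ∏ k ∈ Finset.univ.erase i, w k := by ring
      _ ≤ ν₀ * M * a 1 ^ (t - 1) * ∏ k ∈ Finset.univ.erase i, w k :=
          mul_le_mul_of_nonneg_right hsmall hW0
      _ = ν₀ * M * (a 1 ^ (t - 1) * ∏ k ∈ Finset.univ.erase i, w k) := by ring
      _ ≤ ν₀ * M * ∏ k ∈ Finset.univ.erase i, ∑ n ∈ Finset.Icc 1 u, a n * w k ^ n :=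
          mul_le_mul_of_nonneg_left hscale (mul_nonneg hν₀ hM.le)
  have key0 : ∀ m ∈ Finset.Icc 1 u,
      0 ≤ ∑ j ∈ (Fintype.piFinset fun _ : Fin t => Finset.Icc 1 u).filter (fun j => j i = m),
          C j * ∏ k ∈ Finset.univ.erase i, w k ^ (j k) := fun m _ =>
    Finset.sum_nonneg fun j _ => mul_nonneg (hC j)
      (Finset.prod_nonneg fun k _ => pow_nonneg (hw k).1.le _)
  -- real-rootedness of the reduced row
  have hroots : ∀ z : ℂ, (∑ n ∈ Finset.range u,
      ((∑ j ∈ (Fintype.piFinset (fun _ : Fin t => Finset.Icc 1 u)).filter (fun j => j i = n + 1),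
          C j * ∏ k ∈ Finset.univ.erase i, w k ^ (j k) : ℝ) : ℂ) * z ^ n) = 0 → z.im = 0 := by
    intro z hz
    apply hhyp z
    rw [quantClip_fibreFactor, hz, mul_zero]
  -- abbreviate and apply the core
  set PiF := ∏ k ∈ Finset.univ.erase i, ∑ n ∈ Finset.Icc 1 u, a n * w k ^ n with hPiF
  set α := ∑ T ∈ (Finset.univ.erase i).powerset, θ T * ∏ k ∈ Finset.univ.erase i,
    ∑ n ∈ Finset.Icc 1 u, (if k ∈ T then (-1 : ℝ) ^ (n + 1) else 1) * a n * w k ^ n with hα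
  set β := ∑ T ∈ (Finset.univ.erase i).powerset, θ (insert i T) * ∏ k ∈ Finset.univ.erase i,
    ∑ n ∈ Finset.Icc 1 u, (if k ∈ T then (-1 : ℝ) ^ (n + 1) else 1) * a n * w k ^ n with hβ
  have h2t : (2 : ℝ) ^ t = 2 * 2 ^ (t - 1) := by
    conv_lhs => rw [← ht, pow_succ]
    ring
  have hB : (1 : ℝ) ≤ 2 * 2 ^ (t - 1) := by
    have : (1 : ℝ) ≤ 2 ^ (t - 1) := one_le_pow₀ (by norm_num)
    linarith
  rw [h2t]
  exact quantClip_marginCore hu hPipos hϑ hν₀ hκ hM hεa hB hαb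
    (fun m => ∑ j ∈ (Fintype.piFinset fun _ : Fin t => Finset.Icc 1 u).filter (fun j => j i = m),
      C j * ∏ k ∈ Finset.univ.erase i, w k ^ (j k))
    (fun m => a m * κ) I hI hI0 hI1 key0 key hanat hmargin hroots hr hν₁ hν₂

end Summit.Parity.GeneralizedHardyLittlewood.Cruxes.AbsoluteUpgrade.DipMarginRateExchange

end
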